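/-
Copyright: cell `pub-ymgap` (HUMAN RULING D-0062), Track A of `YM-PLAN.md`, DAG node N20 (= NE7b); R134 acceleration seat
`pub-ymgap-dag-n20-c` (strategy s1, generation 10), module 53.  Released under the licence of the surrounding project.
-/
import Summits.QuantumFields.YangMills.Theorems.BalabanUVNodesN20LCSSmallCouplingRegime
import HarnessLib

/-!
# YM-DAG node N20 (= NE7b), row s1, module 53: THE INSTANCE FOR ARBITRARY PINNED FAMILIES BELOW AN EXPLICIT `g⋆` — module 52 §1 (per-level
# small-coupling threshold) with the threshold DISCHARGED by module 52 §2: the regime is literally «`0 < g_{j+1} ≤ g⋆` at the pinned levels»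

Track A of `YM-PLAN.md` (cell `pub-ymgap`, HUMAN RULING D-0062), node **N20** = spine estimate NE7b (`T4WeightBudget.RelWeightBound`, NOT
PRINTED, NOT PROVED).  Seat `pub-ymgap-dag-n20-c` (R134, s1), generation 10, module 53 (imports module 52 `…N20LCSSmallCouplingRegime`).  One kernel theorem
+ one positivity lemma: 0 `def`, 0 `sorry`, standard axioms; COUNT-NEUTRAL.  Composition of module 52 §1 and §2; it asserts nothing of Bałaban's.

WHY.  Module 52 §1 states the N20 instance for arbitrary pinned families with the PER-LEVEL threshold `4N·B²·(Λ + log m_j∕δ) ≤ p₀(g_{j+1})²` at the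
explicit region size `m_j = d²(9LM₂R_{j+1})^d`, and module 52 §2 proves that threshold for every coupling `0 < g ≤ g⋆ = exp(−t₀∕2)`,
`t₀ = max 1 ((a + b)∕A₀²)`, `a = 4N·B²·(Λ + log(d²(9L²M₂)^d)∕δ)`, `b = 4N·B²·(r·d)∕δ`.  THIS FILE composes them (the two did not fit module 52's 400 lines):
* `epsOfRecord_mul_eta_sq_pos` (the positivity letter `hεη` of 48–52 follows from `0 < g < 1`, `0 < A₀`); ★★★ **`sum_admS_integral_le_rec_pinnedLevels_of_le_gstar`** — on Bałaban's label tower at the residual of record, for ARBITRARY pinned families `D_j` at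
  pinned levels `j ∈ J` whose couplings satisfy `0 < g_{j+1} ≤ g⋆` (explicit in `N, B, C, α, δ, A₀, d, L, M₂, r`), MODULO (W♮) «LCS-j on the hull of the
  (3.2) window's canonical regions» (level-uniform `C`) + (T♮) (the LOCAL [Balaban1985Variational] Thm 1 (9) shape at every χ_{j+1}-cube) and the side
  conditions among the free constants (`0 < α` with the averaging guard, `0 ≤ C`, `0 < δ`, `δ·A·M_h ≤ a₀`, `0 < B`, `0 < A₀`, `1 ≤ p₀`, `0 < M₂` — jointly
  inhabited, module 49 §5): `Σ_{h ∈ class K′} ∫ eterm ρ₀ K′ h dμ_{K′} ≤ exp(−(δ·C·A·M_h²∕39^d)·Σ_{j<K′, j∈J} #D_j)·∫ρ₀ dU₀`.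
  The regime is print's «for g_k sufficiently small» ([Balaban1987RG1] Thm 2: the couplings stay in `]0, γ]`), with NO bookkeeping parameter left
  (`m`, `γ`, `X`, skeleton, counts all gone).

HONEST FRAMING.  Composition only; no estimate of Bałaban's.  (W♮) ((A1c), THE wall, NOT PRINTED as a statement) and (T♮) (K0's pen) stay DISPLAYED;
`M ≫ M₂` (module 43) stays a displayed numerics side condition of the lineage; `g⋆` is crude.  NE7b NOT PRINTED ∕ NOT PROVED; (α)-instance 0∕1; N20 NOT
discharged; typed 28∕28, count untouched; one finite four-torus at fixed `ε` — NOT ℝ⁴, NOT infinite volume, NOT OS, NOT a mass gap, NOT Clay.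

References (LOCATORS): T. Bałaban, CMP 122 (1989) 355–392 [Balaban1989LargeFieldII] ((1.79)–(1.80) pp.383–384, p.383 l.21–28); CMP 119 (1988) 243–285
[Balaban1988Convergent] ((2.4)–(2.5) p.255, (2.16)–(2.17) p.257, (3.2) p.265); CMP 109 (1987) 249–301 [Balaban1987RG1] (Thm 2 p.259); CMP 102 (1985)
277–309 [Balaban1985Variational] (Thm 1 (9) p.279).
-/

set_option autoImplicit false

noncomputable section

open scoped BigOperators ENNReal

namespace Summit.QuantumFields.YangMills.BalabanUVNodes.N20LCSSmallCouplingInstance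

open MeasureTheory
open Literature.MathematicalPhysics.QuantumFieldTheory.Balaban1983to89
open Literature.MathematicalPhysics.QuantumFieldTheory.Balaban1983to89.T4Continuum
open Literature.MathematicalPhysics.QuantumFieldTheory.Balaban1983to89.B14.Eq218Concrete
open Literature.MathematicalPhysics.QuantumFieldTheory.Balaban1983to89.Node00
open B15DeterminingSets B14.Eq213DetSet B14.Eq216Concrete B14.Eq213MaximalDomains B15Eq112TorusCover B14DomainGeom
open Literature.MathematicalPhysics.QuantumFieldTheory.BalabanImbrieJaffe1984to88.BIJ85Eq453GaugeField (qsstarGIter0)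
open ExpMeanLog (deltaSU)
open Summit.QuantumFields.BalabanUV.T4Continuum.B16HistoryIndexedRepr (GoodClass)
open Summit.QuantumFields.BalabanUV.T4Continuum.B16HistoryReprChain
open Summit.QuantumFields.BalabanUV.T4Continuum.NE7b.PrefixExtraction (admS)
open Summit.QuantumFields.YangMills.BalabanUVNodes.N20LCSLabelTower
open Summit.QuantumFields.YangMills.BalabanUVNodes.N20LCSAvgDominationRegion (boxRegion)
open Summit.QuantumFields.YangMills.BalabanUVNodes.N20LCSSmallCouplingRegime
  (sum_admS_integral_le_rec_pinnedLevels_smallCouplings_of_any threshold_le_p0Profile_sq_of_le_gstar)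

variable (F : T4Family) (N : ℕ) [NeZero N] (ν : Stage7Numerics) (M : ℕ) (p : B12.RunParams) (g : ℕ → ℝ) (A₁ : ℝ)

/-- **BELOW `g⋆` THE SMALL-FIELD SCALES ARE POSITIVE**: `0 < g < 1` and `0 < A₀` give `0 < ε(g) = g·A₀(log g⁻²)^{p₀}` and `0 < ε(g)·η²` — the positivity
letter `hεη` of modules 48–52 is a consequence of the regime. [cite: Balaban1988Convergent, (2.4) p.255 (bookkeeping)] -/
theorem epsOfRecord_mul_eta_sq_pos (hA0 : 0 < ν.A₀) {k : ℕ} (hg0 : 0 < g k) (hg1 : g k < 1) :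
    0 < epsOfRecord ν g k * (F.P p.K).eta k ^ 2 := by
  have hlog : 0 < Real.log ((g k) ^ 2)⁻¹ := Real.log_pos ((one_lt_inv₀ (by positivity)).2 (by nlinarith))
  have hε : 0 < epsOfRecord ν g k := by
    unfold epsOfRecord p0Profile
    exact mul_pos hg0 (mul_pos hA0 (pow_pos hlog _))
  have hη : 0 < (F.P p.K).eta k := by
    unfold Params.eta
    exact pow_pos (inv_pos.2 (by exact_mod_cast (F.P p.K).L_pos)) _
  exact mul_pos hε (pow_pos hη 2)

open Classical in
/-- ★★★ **THE INSTANCE AT THE RECORD FOR ARBITRARY PINNED FAMILIES BELOW AN EXPLICIT `g⋆`, MODULO (W♮) + (T♮).**  Module 52 §1 with its per-level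
threshold discharged by module 52 §2: if the pinned-level couplings satisfy `0 < g_{j+1} ≤ g⋆ = exp(−t₀∕2)` (`t₀` explicit in the constants), (W♮) holds
with level-uniform `C` and (T♮) holds at every cube, then `Σ_{h ∈ class K′} ∫ eterm ρ₀ K′ h ≤ exp(−(δ·C·A·M_h²∕39^d)·Σ_{j<K′, j∈J} #D_j)·∫ρ₀` — print's
regime «for g_k sufficiently small», no bookkeeping parameter left (the positivity letter `hεη` of 48–52 is discharged too). [cite: Balaban1989LargeFieldII, (1.79)–(1.80) pp.383–384; Balaban1987RG1, Thm 2 p.259; Balaban1985Variational, Thm 1 (9) p.279] -/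
theorem sum_admS_integral_le_rec_pinnedLevels_of_le_gstar {ρ₀ : cfgOfRecord F N p.K 0 → ℝ}
    (hρ : (bddMeas (cfgOfRecord F N p.K 0)).Gd ρ₀) (h0 : ∀ U, 0 ≤ ρ₀ U) (hM₂ : 0 < ν.M₂)
    (J : Finset ℕ) (hJ : ∀ j ∈ J, j < p.K)
    (D : (j : ℕ) → Finset (Iχ F ν p g j)) {B : ℝ} (hB : 0 < B)
    (hA0 : 0 < ν.A₀) (hp0 : 1 ≤ ν.p₀)
    (hThm1 : ∀ j ∈ J, ∀ (c : Iχ F ν p g j) (V' : GaugeField (F.P p.K) (j + 1) (SU N)) (U₀ : GaugeField (F.P p.K) 0 (SU N)),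
      IsMinimizer (avOfRecord F N p.K) {U | PlaqSmall (ν.εreg * (F.P p.K).eta (j + 1) ^ 2) U}
          (Bj ν.M₁ (cubeEnl (F.P p.K) (sideχ F ν p g j) c 4) (j + 1)) (avgFamily (avOfRecord F N p.K) (qsstarGIter0 (j + 1) V')) U₀ →
      (∀ p' : Plaq (F.P p.K) (j + 1), embIter (j + 1) p'.src ∈ cubeEnl (F.P p.K) (sideχ F ν p g j) c 4 →
        dist1 (GaugeField.plaqHol V' p') < epsOfRecord ν g (j + 1) / B) →
      PlaqSmallOn (plaqInside (cubeEnl (F.P p.K) (sideχ F ν p g j) c 1)) (epsOfRecord ν g (j + 1) * (F.P p.K).eta (j + 1) ^ 2) U₀)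
    {α C a₀ δ : ℝ} (hα : 0 < α)
    (hguard : (((((F.P p.K).d + 2) * (F.P p.K).L : ℕ) : ℝ) ^ 2 / 4) * Real.sqrt (2 * (Fintype.card (Fin N) : ℝ) * α) < deltaSU (Fin N))
    (hC : 0 ≤ C) (hδ : 0 < δ)
    (hδa : δ * ((2 * (Fintype.card (Fin N) : ℝ) * (((F.P p.K).L : ℝ) ^ 2 + 6 * ((((F.P p.K).d + 2) * (F.P p.K).L : ℕ) : ℝ) ^ 2) ^ 2 +
        2 / α) * (((2 * (((F.P p.K).d + 3) * (F.P p.K).L + 2) + 1) ^ (F.P p.K).d * (F.P p.K).d ^ 2 : ℕ) : ℝ)) ≤ a₀)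
    (hgstar : ∀ j ∈ J, 0 < g (j + 1) ∧ g (j + 1) ≤ Real.exp (-(max 1
      ((4 * (Fintype.card (Fin N) : ℝ) * B ^ 2 *
          (C * ((2 * (Fintype.card (Fin N) : ℝ) * (((F.P p.K).L : ℝ) ^ 2 + 6 * ((((F.P p.K).d + 2) * (F.P p.K).L : ℕ) : ℝ) ^ 2) ^ 2 + 2 / α) *
              (((2 * (((F.P p.K).d + 3) * (F.P p.K).L + 2) + 1) ^ (F.P p.K).d * (F.P p.K).d ^ 2 : ℕ) : ℝ)) *
              (((2 * (((F.P p.K).d + 3) * (F.P p.K).L + 2) + 1) ^ (F.P p.K).d * (F.P p.K).d ^ 2 : ℕ) : ℝ) +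
            Real.log (((F.P p.K).d ^ 2 * (9 * (F.P p.K).L * (F.P p.K).L * ν.M₂) ^ (F.P p.K).d : ℕ) : ℝ) / δ) +
        4 * (Fintype.card (Fin N) : ℝ) * B ^ 2 * ((ν.r * (F.P p.K).d : ℕ) : ℝ) / δ) / ν.A₀ ^ 2)) / 2))
    (K' : ℕ) (E : (j : ℕ) → (Fin j → LabelPat F ν p g) → Finset (LbOfRecord F ν p g j)) (hE : ∀ j ∈ J, ∀ h t, t ∈ E j h → D j ⊆ t.1)
    (hW : ∀ j ∈ J, j < K' → ∀ h : Fin j → LabelPat F ν p g,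
      h ∈ admS (labelTowerOfRecord F N ν M p g A₁ (zeta316OfRecord F N ν M A₁)) (labelPattern F ν p g E) j →
      ∀ a : ℝ, 0 ≤ a → a ≤ a₀ → ∀ X : Finset (Plaq (F.P p.K) j),
        (∀ q ∈ X, ∃ c ∈ cubes32 F ν M p g j (seqOfHist F ν M p g j h),
          ∃ p' ∈ (Finset.univ.filter fun q : Plaq (F.P p.K) (j + 1) => embIter (j + 1) q.src ∈ cubeEnl (F.P p.K) (sideχ F ν p g j) c 4),
            q ∈ boxRegion (emb p'.src) (((F.P p.K).d + 3) * (F.P p.K).L + 2)) →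
        ∫ U, Real.exp (a * ((g (j + 1)) ^ 2)⁻¹ * ∑ q ∈ X, (1 - reTr (GaugeField.plaqHol U q))) *
            (labelTowerOfRecord F N ν M p g A₁ (zeta316OfRecord F N ν M A₁)).eterm ρ₀ j h U ∂(lawOfRecord F N p.K j) ≤
          Real.exp (C * a * X.card) * ∫ U, (labelTowerOfRecord F N ν M p g A₁ (zeta316OfRecord F N ν M A₁)).eterm ρ₀ j h U ∂(lawOfRecord F N p.K j)) :
    ∑ h ∈ admS (labelTowerOfRecord F N ν M p g A₁ (zeta316OfRecord F N ν M A₁)) (labelPattern F ν p g E) K',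
        ∫ x, (labelTowerOfRecord F N ν M p g A₁ (zeta316OfRecord F N ν M A₁)).eterm ρ₀ K' h x ∂(lawOfRecord F N p.K K') ≤
      Real.exp (-(δ * (C * ((2 * (Fintype.card (Fin N) : ℝ) * (((F.P p.K).L : ℝ) ^ 2 + 6 * ((((F.P p.K).d + 2) * (F.P p.K).L : ℕ) : ℝ) ^ 2) ^ 2 +
              2 / α) * (((2 * (((F.P p.K).d + 3) * (F.P p.K).L + 2) + 1) ^ (F.P p.K).d * (F.P p.K).d ^ 2 : ℕ) : ℝ)) *
              (((2 * (((F.P p.K).d + 3) * (F.P p.K).L + 2) + 1) ^ (F.P p.K).d * (F.P p.K).d ^ 2 : ℕ) : ℝ))) / (39 : ℝ) ^ (F.P p.K).d *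
          ∑ j ∈ (Finset.range K').filter (· ∈ J), ((D j).card : ℝ)) *
        ∫ U, ρ₀ U ∂(fieldMeasure (F.P p.K) 0 (SU N)) := by
  have hNpos : 0 < (Fintype.card (Fin N) : ℝ) := by
    rw [Fintype.card_fin]; exact_mod_cast Nat.pos_of_ne_zero (NeZero.ne N)
  have hL2 : 2 ≤ (F.P p.K).L := by rw [T4Family.P_L]; have := F.hL.2; omega
  have hΛ0 : 0 ≤ C * ((2 * (Fintype.card (Fin N) : ℝ) * (((F.P p.K).L : ℝ) ^ 2 + 6 * ((((F.P p.K).d + 2) * (F.P p.K).L : ℕ) : ℝ) ^ 2) ^ 2 + 2 / α) *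
      (((2 * (((F.P p.K).d + 3) * (F.P p.K).L + 2) + 1) ^ (F.P p.K).d * (F.P p.K).d ^ 2 : ℕ) : ℝ)) *
      (((2 * (((F.P p.K).d + 3) * (F.P p.K).L + 2) + 1) ^ (F.P p.K).d * (F.P p.K).d ^ 2 : ℕ) : ℝ) := by positivity
  have hg1 : ∀ j ∈ J, g (j + 1) < 1 := fun j hj =>
    lt_of_le_of_lt (hgstar j hj).2 (by
      rw [Real.exp_lt_one_iff, neg_div, neg_lt_zero]; exact div_pos (lt_max_iff.2 (Or.inl one_pos)) two_pos)
  have hεη : ∀ j ∈ J, 0 < epsOfRecord ν g (j + 1) * (F.P p.K).eta (j + 1) ^ 2 := fun j hj =>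
    epsOfRecord_mul_eta_sq_pos F ν p g hA0 (hgstar j hj).1 (hg1 j hj)
  exact sum_admS_integral_le_rec_pinnedLevels_smallCouplings_of_any F N ν M p g A₁ hρ h0 hM₂ J hJ D hB (fun j hj => (hgstar j hj).1) hεη hThm1
    hα hguard hC hδ hδa
    (fun j hj => threshold_le_p0Profile_sq_of_le_gstar ν.r hNpos hB hΛ0 hδ hA0 hp0 (F.P p.K).hd hL2 hM₂ (hgstar j hj).1 (hgstar j hj).2)
    K' E hE hW

end Summit.QuantumFields.YangMills.BalabanUVNodes.N20LCSSmallCouplingInstance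

end
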